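import Summits.QuantumAdvantage.QuantumAdvantage.Theorems.CubicForrelationNearExactIsExactEightFlatSums
import Summits.QuantumAdvantage.QuantumAdvantage.Theorems.CubicForrelationNearExactIsExactLinearTransport
import Summits.QuantumAdvantage.QuantumAdvantage.Theorems.CubicForrelationNearExactIsExactSixteenDigits

/-!
# Crux `CubicForrelation.NearExactIsExact` (stmt-QuantumAdvantage-14043) — Ax divisibility on ANNIHILATOR subspaces and
  general PARAMETRISED FLAT SUMS of `W_g / 2^j`, at every `n` and every flat dimension `k`

Certificate seat `b2b-cforr-cert` (gen 4).  HONEST FRAMING: infrastructure lemmas about cubic Boolean functions (the two-sided analysis of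
the finite slices `n = 14, 16` of the crux needs sums of `u = W_g/2^j` over flats that are NOT coordinate cubes) — NOT summit progress.

* `fs_ax_annihilator`: **Ax/McEliece on the annihilator of `k` vectors.**  For `h : 𝔽₂ⁿ → 𝔽₂` of degree `≤ d` (`d ≥ 1`) and any
  `a₀, …, a_{k−1} ∈ 𝔽₂ⁿ` (no independence assumed), `Σ_{y : aᵢ·y = 0 ∀ i} (−1)^{h(y)} ∈ 2^{⌈(n−k)/d⌉} ℤ`.  Proof: the annihilator is the
  kernel of `y ↦ (aᵢ·y)ᵢ` over `𝔽₂` (bit-vectors read along `ind`), of dimension `m ≥ n − k` (rank–nullity); a basis (Mathlib's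
  `Module.finBasis`) parametrises it linearly and bijectively by `𝔽₂^m`, the pullback of `h` is again of degree `≤ d` (the landed
  `nf_isDegLeFun_mulVec`), and Ax on the full cube of `𝔽₂^m` (the landed `stub_axParity`) gives `2^{⌈m/d⌉} ⊇ 2^{⌈(n−k)/d⌉}`.
  (The tree had this only for coordinate cubes, and for `n = 8`, `k = 4` by a degree trick, `ed_even_card_annihilator`.)
* `fs_sum_twist_flat`, `fs_sum_W_flat`: the Poisson identity over a parametrised `k`-flat `b ⊕ ⟨a₀,…,a_{k−1}⟩` (points `b ⊕ ⊕_{εᵢ=1} aᵢ`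
  counted over all `ε ∈ 𝔽₂^k`): `Σ_ε W_G(b ⊕ a_ε) = 2^k Σ_{y ∈ T} G(y)(−1)^{b·y}`, `T` the annihilator (the landed `ed_sum_W_flat` is `k = 4`).
* `fs_flat_sum_dvd`: **general flat sums.** For cubic `g` on `n` bits with `W_g = 2^j u`: `2^e ∣ Σ_ε u(b ⊕ a_ε)` whenever
  `j + e ≤ k + ⌈(n−k)/3⌉` — e.g. `n = 14`, `u = W_g/32`: `k = 4, 5 ⇒ mod 8`, `k = 6 ⇒ mod 16`; `n = 16`, `u = W_g/64`: `k = 5 ⇒ mod 8`,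
  `k = 6 ⇒ mod 16`, `k = 8 ⇒ mod 32` (numerically checked on random cubics, seat folder `work/c/check14.c`).
* `fs_deg_pullback`, `fs_sum_signOf_flat_dvd`: the pullback of a degree-`≤ d` function along a parametrised `k`-flat has degree `≤ d`,
  so `Σ_ε (−1)^{F(b ⊕ a_ε)} ∈ 2^{⌈k/3⌉} ℤ` for cubic `F`.

References: J. Ax, Amer. J. Math. 86 (1964); R. J. McEliece, Discrete Math. 3 (1972); C. Carlet, *Boolean Functions for Cryptography and
Coding Theory*, CUP 2021, §4.1; R. O'Donnell, *Analysis of Boolean Functions*, CUP 2014, §3.3.  Everything below is proved from Mathlib and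
the tree; axioms are the standard three.
-/

set_option linter.dupNamespace false -- D-0017: single-problem summit ⇒ `QuantumAdvantage.QuantumAdvantage` by design

noncomputable section

namespace Summit.QuantumAdvantage.QuantumAdvantage.Theorems.CubicForrelation.NearExactIsExact

open Finset
open Literature.Computability.QuantumComplexity
open Literature.Computability.QuantumComplexity.BuzetChailloux (bxor zeroVec)
open Literature.Computability.QuantumComplexity.DerivativeWalsh (W)
open Summit.QuantumAdvantage.QuantumAdvantage.Theorems.ExactPairsMaioranaMcFarland.Negative (ind ind_apply ind_injective)
open Summit.QuantumAdvantage.QuantumAdvantage.Theorems.CubicForrelation.ExactPairsMaioranaMcFarland (dnf_twist_eq_chi)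
open Summit.QuantumAdvantage.QuantumAdvantage.Theorems.SignedCubicForrelationNotPrBPP (knf_isDegLeFun_ip
  knf_isDegLeFun_comp)
open scoped Matrix

/-! ### Ax on annihilators -/

/-- `(−1)^{a·y} = 1` iff the `𝔽₂` dot product of the indicator vectors vanishes. [folklore] -/
theorem fs_twist_eq_one_iff {n : ℕ} (a y : Fin n → Bool) : twist a y = 1 ↔ ind a ⬝ᵥ ind y = 0 := by
  rw [dnf_twist_eq_chi]
  rcases (by decide : ∀ c : ZMod 2, c = 0 ∨ c = 1) (ind a ⬝ᵥ ind y) with h | h <;> rw [h]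
  · simp
  · simp only [one_ne_zero, iff_false]
    rw [show (1 : ZMod 2).val = 1 from rfl]
    norm_num

/-- **Ax/McEliece divisibility on the annihilator of `k` vectors.**  For `h` of degree `≤ d` (`d ≥ 1`) on `n` bits and any
`a : Fin k → 𝔽₂ⁿ`: `Σ_{y : aᵢ·y = 0 ∀ i} (−1)^{h(y)} = 2^{⌈(n−k)/d⌉}·z` for an integer `z` (`⌈(n−k)/d⌉ = (n−k+d−1)/d`).
[cite: Carlet2020, §4.1] -/
theorem fs_ax_annihilator {n k d : ℕ} (hd : 1 ≤ d) (h : (Fin n → Bool) → Bool) (hh : IsDegLeFun d h)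
    (a : Fin k → Fin n → Bool) :
    ∃ z : ℤ, ∑ y ∈ univ.filter (fun y : Fin n → Bool => ∀ i, twist (a i) y = 1), signOf (h y) =
      (2 : ℝ) ^ ((n - k + d - 1) / d) * (z : ℝ) := by
  classical
  -- the annihilator as a kernel over `𝔽₂`
  let A : Matrix (Fin k) (Fin n) (ZMod 2) := fun i j => ind (a i) j
  let L : (Fin n → ZMod 2) →ₗ[ZMod 2] (Fin k → ZMod 2) := Matrix.mulVecLin A
  let Kr : Submodule (ZMod 2) (Fin n → ZMod 2) := LinearMap.ker L
  have hmem : ∀ y : Fin n → Bool, (∀ i, twist (a i) y = 1) ↔ ind y ∈ Kr := by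
    intro y
    rw [LinearMap.mem_ker, Matrix.mulVecLin_apply]
    constructor
    · intro hy
      funext i
      exact (fs_twist_eq_one_iff (a i) y).1 (hy i)
    · intro hy i
      exact (fs_twist_eq_one_iff (a i) y).2 (congrFun hy i)
  -- its dimension
  let m : ℕ := Module.finrank (ZMod 2) Kr
  have hdim : n - k ≤ m := by
    have h1 := LinearMap.finrank_range_add_finrank_ker L
    have h2 : Module.finrank (ZMod 2) (LinearMap.range L) ≤ k :=
      (Submodule.finrank_le _).trans (by rw [Module.finrank_fintype_fun_eq_card, Fintype.card_fin])
    rw [Module.finrank_fintype_fun_eq_card, Fintype.card_fin] at h1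
    show n - k ≤ Module.finrank (ZMod 2) (LinearMap.ker L)
    omega
  -- a basis and the linear parametrisation
  let bK := Module.finBasis (ZMod 2) Kr
  let Nm : Matrix (Fin n) (Fin m) (ZMod 2) := fun j c => (bK c : Fin n → ZMod 2) j
  have hNm : ∀ v : Fin m → ZMod 2, Nm *ᵥ v = ((bK.equivFun.symm v : Kr) : Fin n → ZMod 2) := by
    intro v
    rw [Module.Basis.equivFun_symm_apply, Submodule.coe_sum]
    funext j
    simp only [Matrix.mulVec, dotProduct, Submodule.coe_smul, Finset.sum_apply, Pi.smul_apply, smul_eq_mul, Nm]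
    exact Finset.sum_congr rfl fun c _ => mul_comm _ _
  let φ : (Fin m → Bool) → (Fin n → Bool) := fun e j => decide ((Nm *ᵥ ind e) j = 1)
  have hφind : ∀ e, ind (φ e) = Nm *ᵥ ind e := fun e => lt_ind_decide _
  have hinj : Function.Injective φ := by
    intro e e' hee
    have h1 : Nm *ᵥ ind e = Nm *ᵥ ind e' := by rw [← hφind, ← hφind, hee]
    rw [hNm, hNm] at h1
    have h2 : bK.equivFun.symm (ind e) = bK.equivFun.symm (ind e') := Subtype.ext h1
    exact ind_injective (bK.equivFun.symm.injective h2)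
  have himage : univ.filter (fun y : Fin n → Bool => ∀ i, twist (a i) y = 1) = univ.image φ := by
    ext y
    simp only [mem_filter, mem_univ, true_and, mem_image]
    constructor
    · intro hy
      have hyK : ind y ∈ Kr := (hmem y).1 hy
      let w : Fin m → ZMod 2 := bK.equivFun ⟨ind y, hyK⟩
      refine ⟨fun c => decide (w c = 1), ?_⟩
      apply ind_injective
      rw [hφind, lt_ind_decide, hNm, LinearEquiv.symm_apply_apply]
    · rintro ⟨e, rfl⟩
      rw [hmem, hφind, hNm]
      exact ((bK.equivFun.symm (ind e) : Kr)).2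
  -- Ax on the full cube of the parameter space
  have hdeg : IsDegLeFun d (fun e => h (φ e)) := nf_isDegLeFun_mulVec Nm (fun v i => decide (v i = 1)) lt_ind_decide hh
  obtain ⟨z, hz⟩ := stub_axParity m d _ univ hd hdeg
  rw [filter_true_of_mem (fun (u : Fin m → Bool) (_ : u ∈ univ) i (_ : u i = true) => mem_univ i), card_univ,
    Fintype.card_fin] at hz
  have hle : (n - k + d - 1) / d ≤ (m + d - 1) / d := Nat.div_le_div_right (by omega)
  refine ⟨2 ^ ((m + d - 1) / d - (n - k + d - 1) / d) * z, ?_⟩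
  rw [himage, sum_image fun e _ e' _ hee => hinj hee, hz]
  push_cast
  rw [← mul_assoc, ← pow_add, Nat.add_sub_cancel' hle]

/-! ### Poisson over a parametrised `k`-flat -/

/-- **Character sum over a parametrised `k`-flat.** `Σ_ε (−1)^{(b ⊕ a_ε)·y} = 2^k·(−1)^{b·y}` if `y` annihilates every `aᵢ`, and `0`
otherwise. [cite: ODonnell2014, §3.3] -/
theorem fs_sum_twist_flat {n k : ℕ} (b : Fin n → Bool) (a : Fin k → Fin n → Bool) (y : Fin n → Bool) :
    ∑ ε : Fin k → Bool, twist (fun j => b j ^^ decide (Odd #(univ.filter fun i => ε i && a i j))) y =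
      if (∀ i, twist (a i) y = 1) then 2 ^ k * twist b y else 0 := by
  classical
  simp_rw [ed_twist_flatPt]
  rw [← mul_sum, ← Fintype.prod_sum (fun i (e : Bool) => if e then twist (a i) y else (1 : ℝ))]
  have hb : ∀ i, ∑ e : Bool, (if e then twist (a i) y else (1 : ℝ)) = twist (a i) y + 1 := by
    intro i
    rw [Fintype.sum_bool]
    simp
  simp_rw [hb]
  split_ifs with hall
  · rw [prod_congr rfl fun i _ => show twist (a i) y + 1 = 2 by rw [hall i]; norm_num, prod_const, card_univ,
      Fintype.card_fin, mul_comm]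
  · push Not at hall
    obtain ⟨i, hi⟩ := hall
    have hneg : twist (a i) y = -1 := (Simon.twist_eq_one_or (a i) y).resolve_left hi
    rw [prod_eq_zero (mem_univ i) (by rw [hneg]; norm_num), mul_zero]

/-- **Poisson over a parametrised `k`-flat**: `Σ_ε W_G(b ⊕ a_ε) = 2^k·Σ_{y : aᵢ·y = 0 ∀i} G(y)(−1)^{b·y}` for every real `G`.
[cite: ODonnell2014, §3.3] -/
theorem fs_sum_W_flat {n k : ℕ} (G : (Fin n → Bool) → ℝ) (b : Fin n → Bool) (a : Fin k → Fin n → Bool) :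
    ∑ ε : Fin k → Bool, W G (fun j => b j ^^ decide (Odd #(univ.filter fun i => ε i && a i j))) =
      2 ^ k * ∑ y ∈ univ.filter (fun y => ∀ i, twist (a i) y = 1), G y * twist b y := by
  classical
  unfold W
  rw [sum_comm]
  simp_rw [← mul_sum]
  rw [mul_sum, ← sum_filter_add_sum_filter_not univ (fun y : Fin n → Bool => ∀ i, twist (a i) y = 1)]
  have h1 : ∑ y ∈ univ.filter (fun y => ∀ i, twist (a i) y = 1),
      G y * ∑ ε : Fin k → Bool, twist y (fun j => b j ^^ decide (Odd #(univ.filter fun i => ε i && a i j))) =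
      ∑ y ∈ univ.filter (fun y => ∀ i, twist (a i) y = 1), 2 ^ k * (G y * twist b y) := by
    refine sum_congr rfl fun y hy => ?_
    simp_rw [twist_comm y]
    rw [fs_sum_twist_flat, if_pos (mem_filter.1 hy).2]
    ring
  have h2 : ∑ y ∈ univ.filter (fun y => ¬ ∀ i, twist (a i) y = 1),
      G y * ∑ ε : Fin k → Bool, twist y (fun j => b j ^^ decide (Odd #(univ.filter fun i => ε i && a i j))) = 0 := by
    refine sum_eq_zero fun y hy => ?_
    simp_rw [twist_comm y]
    rw [fs_sum_twist_flat, if_neg (mem_filter.1 hy).2, mul_zero]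
  rw [h1, h2, add_zero]

/-! ### General flat sums of `u = W_g / 2^j` -/

/-- **General flat sums.** For cubic `g` on `n` bits with `W_g = 2^j·u`, every base point `b`, every `k` directions `a` (no
independence assumed; the sum runs over all `2^k` parameters with multiplicity) and every `e` with `j + e ≤ k + ⌈(n−k)/3⌉`:
`2^e ∣ Σ_ε u(b ⊕ a_ε)`.  (Poisson: `2^j Σ_ε u = 2^k Σ_{y∈T} (−1)^{g(y) ⊕ b·y}`, and Ax on the annihilator `T` for the cubic
`g ⊕ ℓ_b`.) [this work] -/
theorem fs_flat_sum_dvd {n k j e : ℕ} (g : (Fin n → Bool) → Bool) (u : (Fin n → Bool) → ℤ) (hg : IsDegLeFun 3 g)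
    (hu : ∀ x, W (fun y => signOf (g y)) x = (2 : ℝ) ^ j * (u x : ℝ)) (b : Fin n → Bool) (a : Fin k → Fin n → Bool)
    (he : j + e ≤ k + (n - k + 2) / 3) :
    (2 : ℤ) ^ e ∣ ∑ ε : Fin k → Bool, u (fun l => b l ^^ decide (Odd #(univ.filter fun i => ε i && a i l))) := by
  classical
  have hW := fs_sum_W_flat (fun y => signOf (g y)) b a
  simp_rw [hu] at hW
  rw [← mul_sum] at hW
  have hsg : ∀ y : Fin n → Bool, signOf (g y) * twist b y =
      signOf (g y ^^ decide (Odd #(univ.filter fun i => y i && b i))) := by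
    intro y
    rw [twist_comm, vg_twist_eq_signOf, ← signOf_xor]
  simp_rw [hsg] at hW
  have hdeg : IsDegLeFun 3 (fun y : Fin n → Bool => g y ^^ decide (Odd #(univ.filter fun i => y i && b i))) :=
    bb_isDegLeFun_bxor hg ((knf_isDegLeFun_ip b).mono (by norm_num))
  obtain ⟨z, hz⟩ := fs_ax_annihilator (d := 3) (by norm_num) _ hdeg a
  rw [hz, show n - k + 3 - 1 = n - k + 2 by omega] at hW
  have hZ : (2 : ℤ) ^ j * ∑ ε : Fin k → Bool, u (fun l => b l ^^ decide (Odd #(univ.filter fun i => ε i && a i l))) =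
      2 ^ k * (2 ^ ((n - k + 2) / 3) * z) := by
    have h' : (((2 : ℤ) ^ j * ∑ ε : Fin k → Bool, u (fun l => b l ^^ decide (Odd #(univ.filter fun i => ε i && a i l))) : ℤ)
        : ℝ) = ((2 ^ k * (2 ^ ((n - k + 2) / 3) * z) : ℤ) : ℝ) := by
      push_cast
      linarith
    exact_mod_cast h'
  exact sx_dvd_of_balance he hZ

/-! ### Pullbacks along parametrised flats -/

/-- The pullback of a degree-`≤ d` function along an affine parametrisation `ε ↦ b ⊕ ⊕_{εᵢ=1} aᵢ` has degree `≤ d`.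
[cite: Carlet2020, §2.2.1 Def. 6] -/
theorem fs_deg_pullback {n k d : ℕ} (F : (Fin n → Bool) → Bool) (hF : IsDegLeFun d F) (b : Fin n → Bool)
    (a : Fin k → Fin n → Bool) :
    IsDegLeFun d (fun ε : Fin k → Bool => F (fun j => b j ^^ decide (Odd #(univ.filter fun i => ε i && a i j)))) :=
  knf_isDegLeFun_comp hF _ fun j => bb_isDegLeFun_bxor (isDegLeFun_const 1 (b j)) (knf_isDegLeFun_ip fun i => a i j)

/-- **Ax on a parametrised `k`-flat**: for cubic `F` on `n` bits, `Σ_{ε ∈ 𝔽₂^k} (−1)^{F(b ⊕ a_ε)} = 2^{⌈k/3⌉}·z`.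
[cite: Carlet2020, §4.1] -/
theorem fs_sum_signOf_flat_dvd {n k : ℕ} (F : (Fin n → Bool) → Bool) (hF : IsDegLeFun 3 F) (b : Fin n → Bool)
    (a : Fin k → Fin n → Bool) :
    ∃ z : ℤ, ∑ ε : Fin k → Bool, signOf (F (fun j => b j ^^ decide (Odd #(univ.filter fun i => ε i && a i j)))) =
      (2 : ℝ) ^ ((k + 2) / 3) * (z : ℝ) := by
  classical
  obtain ⟨z, hz⟩ := stub_axParity k 3 _ univ (by norm_num) (fs_deg_pullback F hF b a)
  rw [filter_true_of_mem (fun (u : Fin k → Bool) (_ : u ∈ univ) i (_ : u i = true) => mem_univ i), card_univ,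
    Fintype.card_fin, show (k + 3 - 1) / 3 = (k + 2) / 3 by omega] at hz
  exact ⟨z, hz⟩

end Summit.QuantumAdvantage.QuantumAdvantage.Theorems.CubicForrelation.NearExactIsExact

end
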